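import Summits.ValiantsHypothesis.ValiantsHypothesis.Theorems.BarrierLeverAnchoredDoorHitsLowerPairsRelApexSpec

/-!
# Support item `AnchoredDoorHitsLowerPairs` (stmt-ValiantsHypothesis-22510), line `anchored-peeling`:
# THE RELATIVE, TYPED APEX LEMMA — rows any family `R` (split `R₀ ⊔ n∗R₁`), lifted labels `W` and `W ∖ γ`, and the injective-label criterion

Helper file (`--supports stmt-ValiantsHypothesis-22510`; cell valiant-natproofs, rung V4, 𝒟-side door (c); registered line
`Cruxes/AnchoredDoorHitsLowerPairs/Lines/anchored_peeling.lean` v17/v18, registered residual `Stmt.stub_apexRest`; prover seat val-np-p1 gen 22;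
memo HOME/val-np-p1/g22/MEMO-relapex-valnp1-g22.md). Closes NO item.

WHY. The Apex Lemma (`indepCols_apex`, file `…ApexLemma`) reads the door columns of a family `F` on the FULL cube of rows `2^X` and allows ONE move at the
split variable `x_n` (apex `v⋆ ↦ x_n`, a tail set `G₁`). Two things are generalised here, with the same linear-algebra proof:
* ROWS: an arbitrary family `R` of row faces (the item's rows are a lower family `R`, a cube only in the special case `r = 2^{|X|}`); the split is
  `R₀ = {U ∈ R : n ∉ U}` (`delFam R n`) and `R₁ = {U ∖ n : n ∈ U ∈ R}` (`linkFam R n`). The fixed-profile face-UQ residual contains, for EVERY size `r`,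
  «deep versus wide» pairs whose deep side is NOT a cube (cubes minus a few top faces, punctured cubes `2^[m] ∖ ↑{p,q}`, joins of cubes with small
  complexes); the cube-row recursion (`IsApexPair`) does not reach them, the relative one does.
* VERTEX TYPES at the split (file `…RelApexSpec`; memo g21 §11): TAIL set `G₁`, ROOT set `G₂`; a column `W ∌ v⋆` has the bottom LABELS `W` (if `W` meets
  `G₁`) and `W ∖ γ`, `γ ∈ W ∩ G₂` (`labelsT`).

**THE LEMMA (`indepColsR_apexT`).** Let `L = linkFam F v⋆`, `F' = delFam F v⋆`, `T ⊆ F'` and a label choice `λ : T → faces` with: every label of every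
column of `F'` lies in `L ∪ λ(T)`; `λ(Y₀)` is a label of `Y₀`, is not in `L`, and is a label of no other column of `F'`. If the columns `F' ∖ T` are independent
on the rows `R₀` and the columns `L ∪ λ(T)` are independent on the rows `R₁` (doors `D''`, free of `x_n`), then the columns of `F` are independent on the rows
`R` for the typed apex specialisation. (Proof: the `n ∗ R₁` equations are a vanishing combination of the columns `L ∪ λ(T)` — each chosen label occurs in
exactly one column; this kills the coefficients on `T`; the `R₀` equations then kill `F' ∖ T`; finally the `L`-coefficients vanish.) Move A of the Apex Lemma is
the case `G₂ = ∅`, `λ = id`, `R = 2^X`. No lowerness, no profile condition, no counting is used.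

WHAT THIS IS NOT: no claim about which pairs admit such a split (that is the recursion of the sequel file and its census); nothing on crux
stmt-ValiantsHypothesis-14610 or on `VP` versus `VNP`.
-/

set_option linter.dupNamespace false

namespace Summit.ValiantsHypothesis.ValiantsHypothesis.Theorems.BarrierLever.AnchoredPeeling

open Finset MvPolynomial
open Summit.ValiantsHypothesis.ValiantsHypothesis.Theorems.BarrierLever.BrickCalculus (pexpo pexpo_def pexpo_le_iff pexpo_sub
  pexpo_apply_castAdd pexpo_apply_natAdd)

noncomputable section

variable {h : ℕ}

/-! ## Relative independence, deletion / link / label families, and the typed relative Apex Lemma -/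

/-- **Linear independence of the door columns of `F` on the row family `R`** (finite-sum form): every vanishing linear combination of the column
vectors `U ↦ [x^U] ∏_{γ∈W} D_γ` (`U ∈ R`), `W ∈ F`, is trivial. `IndepCols X F = IndepColsR (2^X) F`. -/
def IndepColsR (R F : Finset (Finset (Fin h))) (θ : Fin h → Fin h → ℂ) (φ : Fin h → Fin h → Fin h → ℂ) : Prop :=
  ∀ g : Finset (Fin h) → ℂ,
    (∀ U ∈ R, ∑ W ∈ F, g W * coeff (pexpo U ∅) (∏ γ ∈ W, doorElem θ φ γ) = 0) → ∀ W ∈ F, g W = 0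

/-- The cube-row notion is the relative notion on the rows `2^X`. -/
theorem indepCols_iff_indepColsR (X : Finset (Fin h)) (F : Finset (Finset (Fin h))) (θ : Fin h → Fin h → ℂ) (φ : Fin h → Fin h → Fin h → ℂ) :
    IndepCols X F θ φ ↔ IndepColsR X.powerset F θ φ := by
  constructor
  · intro hI g hg
    exact hI g (fun U hU => hg U (Finset.mem_powerset.mpr hU))
  · intro hI g hg
    exact hI g (fun U hU => hg U (Finset.mem_powerset.mp hU))

/-- The deletion family of the vertex / variable `v`: the members avoiding `v`. -/
def delFam (F : Finset (Finset (Fin h))) (v : Fin h) : Finset (Finset (Fin h)) := F.filter (fun W => v ∉ W)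

/-- The link family of the vertex / variable `v`: `{W ∖ v : v ∈ W ∈ F}`. -/
def linkFam (F : Finset (Finset (Fin h))) (v : Fin h) : Finset (Finset (Fin h)) := (F.filter (fun W => v ∈ W)).image (fun W => W.erase v)

/-- The bottom LABELS of a column `Y ∌ v⋆` under the typed specialisation: `Y` itself if `Y` meets the tail set `G₁`, and `Y ∖ γ` for `γ ∈ Y ∩ G₂`. -/
def labelsT (G₁ G₂ : Finset (Fin h)) (Y : Finset (Fin h)) : Finset (Finset (Fin h)) :=
  (if (Y ∩ G₁).Nonempty then {Y} else ∅) ∪ (Y ∩ G₂).image (fun γ => Y.erase γ)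

/-- Membership in the deletion family. -/
theorem mem_delFam {F : Finset (Finset (Fin h))} {v : Fin h} {Y : Finset (Fin h)} : Y ∈ delFam F v ↔ Y ∈ F ∧ v ∉ Y := Finset.mem_filter

/-- Membership in the link family. -/
theorem mem_linkFam {F : Finset (Finset (Fin h))} {v : Fin h} {Y : Finset (Fin h)} : Y ∈ linkFam F v ↔ v ∉ Y ∧ insert v Y ∈ F := by
  classical
  rw [linkFam, Finset.mem_image]
  constructor
  · rintro ⟨W, hW, rfl⟩
    rw [Finset.mem_filter] at hW
    exact ⟨Finset.notMem_erase v W, by rw [Finset.insert_erase hW.2]; exact hW.1⟩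
  · rintro ⟨hv, hins⟩
    exact ⟨insert v Y, Finset.mem_filter.mpr ⟨hins, Finset.mem_insert_self v Y⟩, Finset.erase_insert hv⟩

/-- Membership in the label family. -/
theorem mem_labelsT {G₁ G₂ Y μ : Finset (Fin h)} :
    μ ∈ labelsT G₁ G₂ Y ↔ (μ = Y ∧ (Y ∩ G₁).Nonempty) ∨ ∃ γ ∈ Y ∩ G₂, Y.erase γ = μ := by
  classical
  rw [labelsT, Finset.mem_union, Finset.mem_image]
  by_cases hne : (Y ∩ G₁).Nonempty
  · rw [if_pos hne, Finset.mem_singleton]; simp only [hne, and_true]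
  · rw [if_neg hne]; simp only [Finset.notMem_empty, hne, and_false, false_or]

/-- A column is not one of its own erased labels. -/
theorem erase_ne_self_of_mem {Y : Finset (Fin h)} {γ : Fin h} (hγ : γ ∈ Y) : Y.erase γ ≠ Y :=
  fun heq => (Finset.notMem_erase γ Y) (by rw [heq]; exact hγ)

/-- **THE TYPED RELATIVE APEX LEMMA.** See the file header. Rows `R` split into `delFam R n` and `linkFam R n`; columns `F` split by the apex `v⋆` into
`F' = delFam F v⋆` and the link `L = linkFam F v⋆`; `T ⊆ F'` are the lifted columns with chosen labels `λ(Y) ∈ labelsT G₁ G₂ Y`, not in `L`, owned by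
one column each, and every label of every column of `F'` lies in `L ∪ λ(T)`. If `F' ∖ T` is independent on `delFam R n` and `L ∪ λ(T)` on `linkFam R n`
(doors `θ'', φ''` off `x_n`), then `F` is independent on `R` for the typed apex specialisation. -/
theorem indepColsR_apexT {n vs : Fin h} (R F T : Finset (Finset (Fin h))) (G₁ G₂ : Finset (Fin h)) (lam : Finset (Fin h) → Finset (Fin h))
    (hTF : T ⊆ delFam F vs)
    (hsupp : ∀ Y ∈ delFam F vs, labelsT G₁ G₂ Y ⊆ linkFam F vs ∪ T.image lam)
    (hown : ∀ Y₀ ∈ T, ∀ Y ∈ delFam F vs, lam Y₀ ∈ labelsT G₁ G₂ Y → Y = Y₀)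
    (hlamL : ∀ Y₀ ∈ T, lam Y₀ ∉ linkFam F vs)
    (hlamT : ∀ Y₀ ∈ T, lam Y₀ ∈ labelsT G₁ G₂ Y₀)
    {θ'' : Fin h → Fin h → ℂ} {φ'' : Fin h → Fin h → Fin h → ℂ} (hθ : ∀ γ, θ'' n γ = 0) (hφ : ∀ b γ, φ'' b γ n = 0)
    (h0 : IndepColsR (delFam R n) (delFam F vs \ T) θ'' φ'')
    (h1 : IndepColsR (linkFam R n) (linkFam F vs ∪ T.image lam) θ'' φ'') :
    IndepColsR R F (apexThetaT θ'' vs n G₂) (apexPhiT φ'' vs n G₁) := by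
  classical
  intro g hg
  set F' := delFam F vs with hF'
  set L := linkFam F vs with hL
  set M := L ∪ T.image lam with hM
  set t : Finset (Fin h) → Finset (Fin h) → ℂ := fun Y U => coeff (pexpo U ∅) (∏ γ ∈ Y, doorElem θ'' φ'' γ) with ht
  set c : Finset (Fin h) → ℂ := fun Y => ∑ γ ∈ Y, tailInd G₁ γ with hc
  -- the coefficient of the label `μ` in the bottom part of the column `Y`
  set cf : Finset (Fin h) → Finset (Fin h) → ℂ := fun Y μ => if μ = Y then c Y else 1 with hcf
  -- split F into F' and the columns through vs
  have hsplit : ∀ U, ∑ W ∈ F, g W * coeff (pexpo U ∅) (∏ γ ∈ W, doorElem (apexThetaT θ'' vs n G₂) (apexPhiT φ'' vs n G₁) γ) =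
      ∑ W ∈ F', g W * coeff (pexpo U ∅) (∏ γ ∈ W, doorElem (apexThetaT θ'' vs n G₂) (apexPhiT φ'' vs n G₁) γ) +
      ∑ W ∈ F.filter (fun W => vs ∈ W), g W * coeff (pexpo U ∅) (∏ γ ∈ W, doorElem (apexThetaT θ'' vs n G₂) (apexPhiT φ'' vs n G₁) γ) := by
    intro U
    rw [hF', delFam, ← Finset.sum_filter_add_sum_filter_not F (fun W => vs ∉ W)]
    congr 1
    exact Finset.sum_congr (Finset.filter_congr (fun W _ => by rw [not_not])) (fun _ _ => rfl)
  -- (i) the bottom part of a column Y ∈ F', as a combination of its labels, all of which lie in M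
  have hbot_col : ∀ Y ∈ F', ∀ U₀ : Finset (Fin h), n ∉ U₀ →
      coeff (pexpo (insert n U₀) ∅) (∏ γ ∈ Y, doorElem (apexThetaT θ'' vs n G₂) (apexPhiT φ'' vs n G₁) γ) =
        ∑ μ ∈ M, (if μ ∈ labelsT G₁ G₂ Y then cf Y μ * t μ U₀ else 0) := by
    intro Y hY U₀ hnU₀
    have hvsY : vs ∉ Y := (mem_delFam.mp hY).2
    rw [coeff_prod_doorElem_apexT_notMem hvsY hθ hφ, if_pos (Finset.mem_insert_self n U₀), Finset.erase_insert hnU₀]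
    -- restrict the sum over M to the labels of Y
    rw [← Finset.sum_filter, Finset.filter_mem_eq_inter, Finset.inter_eq_right.mpr (hsupp Y hY)]
    -- labels = ({Y} if Y meets G₁) ⊔ erased labels
    have hdisj : Disjoint (if (Y ∩ G₁).Nonempty then ({Y} : Finset (Finset (Fin h))) else ∅) ((Y ∩ G₂).image (fun γ => Y.erase γ)) := by
      rw [Finset.disjoint_left]
      intro μ hμ hμ'
      obtain ⟨γ, hγ, rfl⟩ := Finset.mem_image.mp hμ'
      have hμY : Y.erase γ = Y := by
        by_cases hne : (Y ∩ G₁).Nonempty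
        · rw [if_pos hne, Finset.mem_singleton] at hμ; exact hμ
        · rw [if_neg hne] at hμ; exact absurd hμ (Finset.notMem_empty _)
      exact erase_ne_self_of_mem (Finset.mem_inter.mp hγ).1 hμY
    rw [labelsT, Finset.sum_union hdisj]
    congr 1
    · -- the label Y itself
      by_cases hne : (Y ∩ G₁).Nonempty
      · rw [if_pos hne, Finset.sum_singleton, hcf]
        simp only [if_true]
        rfl
      · rw [if_neg hne, Finset.sum_empty]
        have hc0 : ∑ γ ∈ Y, tailInd G₁ γ = 0 := by
          by_contra hne'
          exact hne ((sum_tailInd_ne_zero_iff Y).mp hne')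
        rw [hc0, zero_mul]
    · -- the erased labels
      rw [Finset.sum_image (fun γ hγ γ' hγ' heq => (Finset.erase_injOn Y (Finset.mem_inter.mp hγ).1 (Finset.mem_inter.mp hγ').1 heq))]
      rw [← Finset.sum_filter_add_sum_filter_not Y (fun γ => γ ∈ G₂)]
      have hz : ∑ γ ∈ Y.filter (fun γ => γ ∉ G₂), rootInd G₂ γ * t (Y.erase γ) U₀ = 0 :=
        Finset.sum_eq_zero (fun γ hγ => by rw [rootInd, if_neg (Finset.mem_filter.mp hγ).2, zero_mul])
      rw [hz, add_zero, Finset.filter_mem_eq_inter]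
      refine Finset.sum_congr rfl (fun γ hγ => ?_)
      rw [rootInd, if_pos (Finset.mem_inter.mp hγ).2, one_mul, hcf]
      simp only [if_neg (erase_ne_self_of_mem (Finset.mem_inter.mp hγ).1), one_mul]
      rfl
  -- (ii) the bottom equations: a vanishing combination of the columns of M on the rows linkFam R n
  set Gf : Finset (Fin h) → ℂ := fun μ => (if μ ∈ L then g (insert vs μ) else 0) + ∑ Y ∈ F', (if μ ∈ labelsT G₁ G₂ Y then g Y * cf Y μ else 0)
    with hGf
  have hbot : ∀ U₀ ∈ linkFam R n, ∑ μ ∈ M, Gf μ * t μ U₀ = 0 := by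
    intro U₀ hU₀
    obtain ⟨hnU₀, hins⟩ := mem_linkFam.mp hU₀
    have key := hg (insert n U₀) hins
    rw [hsplit] at key
    -- first block: columns of F'
    have hA : ∑ W ∈ F', g W * coeff (pexpo (insert n U₀) ∅) (∏ γ ∈ W, doorElem (apexThetaT θ'' vs n G₂) (apexPhiT φ'' vs n G₁) γ) =
        ∑ μ ∈ M, (∑ Y ∈ F', (if μ ∈ labelsT G₁ G₂ Y then g Y * cf Y μ else 0)) * t μ U₀ := by
      rw [Finset.sum_congr rfl (fun W hW => by rw [hbot_col W hW U₀ hnU₀, Finset.mul_sum]), Finset.sum_comm]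
      refine Finset.sum_congr rfl (fun μ _ => ?_)
      rw [Finset.sum_mul]
      refine Finset.sum_congr rfl (fun Y _ => ?_)
      split_ifs <;> ring
    -- second block: columns through vs, reindexed by the link
    have hB : ∑ W ∈ F.filter (fun W => vs ∈ W), g W * coeff (pexpo (insert n U₀) ∅)
        (∏ γ ∈ W, doorElem (apexThetaT θ'' vs n G₂) (apexPhiT φ'' vs n G₁) γ) = ∑ μ ∈ M, (if μ ∈ L then g (insert vs μ) else 0) * t μ U₀ := by
      have hLM : ∑ μ ∈ M, (if μ ∈ L then g (insert vs μ) else 0) * t μ U₀ = ∑ μ ∈ L, g (insert vs μ) * t μ U₀ := by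
        rw [← Finset.sum_filter_add_sum_filter_not M (fun μ => μ ∈ L)]
        have hz : ∑ μ ∈ M.filter (fun μ => μ ∉ L), (if μ ∈ L then g (insert vs μ) else 0) * t μ U₀ = 0 :=
          Finset.sum_eq_zero (fun μ hμ => by rw [if_neg (Finset.mem_filter.mp hμ).2, zero_mul])
        rw [hz, add_zero, Finset.filter_mem_eq_inter, Finset.inter_eq_right.mpr Finset.subset_union_left]
        exact Finset.sum_congr rfl (fun μ hμ => by rw [if_pos hμ])
      rw [hLM, hL, linkFam, Finset.sum_image]
      · refine Finset.sum_congr rfl (fun W hW => ?_)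
        have hvsW : vs ∈ W := (Finset.mem_filter.mp hW).2
        rw [coeff_prod_doorElem_apexT_mem hvsW hθ hφ, if_pos (Finset.mem_insert_self n U₀), Finset.erase_insert hnU₀, Finset.insert_erase hvsW]
      · intro W hW W' hW' heq
        exact Finset.erase_injOn' vs (Finset.mem_filter.mp hW).2 (Finset.mem_filter.mp hW').2 heq
    rw [hA, hB, ← Finset.sum_add_distrib] at key
    rw [← key]
    refine Finset.sum_congr rfl (fun μ _ => ?_)
    rw [hGf]
    ring
  have hzero1 := h1 Gf hbot
  -- (iii) the coefficients on T vanish: the chosen label of Y₀ is owned by Y₀ alone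
  have hgT : ∀ Y₀ ∈ T, g Y₀ = 0 := by
    intro Y₀ hY₀
    have hμM : lam Y₀ ∈ M := Finset.mem_union_right _ (Finset.mem_image_of_mem lam hY₀)
    have := hzero1 (lam Y₀) hμM
    rw [hGf] at this
    simp only at this
    rw [if_neg (hlamL Y₀ hY₀), zero_add, Finset.sum_eq_single_of_mem Y₀ (hTF hY₀)
      (fun Y hY hne => if_neg (fun hmem => hne (hown Y₀ hY₀ Y hY hmem))), if_pos (hlamT Y₀ hY₀)] at this
    have hcf0 : cf Y₀ (lam Y₀) ≠ 0 := by
      rw [hcf]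
      simp only
      by_cases heq : lam Y₀ = Y₀
      · rw [if_pos heq]
        -- lam Y₀ = Y₀ is a label of Y₀ only through the tail part
        have hne : (Y₀ ∩ G₁).Nonempty := by
          rcases mem_labelsT.mp (hlamT Y₀ hY₀) with ⟨-, hne⟩ | ⟨γ, hγ, hγeq⟩
          · exact hne
          · exact absurd (hγeq.trans heq) (erase_ne_self_of_mem (Finset.mem_inter.mp hγ).1)
        exact (sum_tailInd_ne_zero_iff Y₀).mpr hne
      · rw [if_neg heq]; exact one_ne_zero
    rcases mul_eq_zero.mp this with h' | h'
    · exact h'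
    · exact absurd h' hcf0
  -- (iv) the top equations: a vanishing combination of the columns of F' \ T on the rows delFam R n
  have htop : ∀ U ∈ delFam R n, ∑ W ∈ F' \ T, g W * t W U = 0 := by
    intro U hU
    have hnU : n ∉ U := (mem_delFam.mp hU).2
    have key := hg U (mem_delFam.mp hU).1
    rw [hsplit] at key
    have hB : ∑ W ∈ F.filter (fun W => vs ∈ W), g W * coeff (pexpo U ∅)
        (∏ γ ∈ W, doorElem (apexThetaT θ'' vs n G₂) (apexPhiT φ'' vs n G₁) γ) = 0 :=
      Finset.sum_eq_zero (fun W hW => by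
        rw [coeff_prod_doorElem_apexT_mem (Finset.mem_filter.mp hW).2 hθ hφ, if_neg hnU, mul_zero])
    rw [hB, add_zero] at key
    have hA : ∑ W ∈ F', g W * coeff (pexpo U ∅) (∏ γ ∈ W, doorElem (apexThetaT θ'' vs n G₂) (apexPhiT φ'' vs n G₁) γ) =
        ∑ W ∈ F', g W * t W U :=
      Finset.sum_congr rfl (fun W hW => by rw [coeff_prod_doorElem_apexT_notMem (mem_delFam.mp hW).2 hθ hφ, if_neg hnU])
    rw [hA] at key
    have hT0 : ∑ Y ∈ T, g Y * t Y U = 0 := Finset.sum_eq_zero (fun Y hY => by rw [hgT Y hY, zero_mul])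
    rw [← Finset.sum_sdiff hTF, hT0, add_zero] at key
    exact key
  have hzero0 := h0 g htop
  have hgF' : ∀ Y ∈ F', g Y = 0 := by
    intro Y hY
    by_cases hYT : Y ∈ T
    · exact hgT Y hYT
    · exact hzero0 Y (Finset.mem_sdiff.mpr ⟨hY, hYT⟩)
  -- (v) conclude
  intro W hW
  by_cases hvsW : vs ∈ W
  · have hYL : W.erase vs ∈ L := mem_linkFam.mpr ⟨Finset.notMem_erase vs W, by rw [Finset.insert_erase hvsW]; exact hW⟩
    have := hzero1 (W.erase vs) (Finset.mem_union_left _ hYL)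
    rw [hGf] at this
    simp only at this
    rw [if_pos hYL, Finset.insert_erase hvsW, Finset.sum_eq_zero (fun Y hY => by rw [hgF' Y hY, zero_mul, ite_self]), add_zero] at this
    exact this
  · exact hgF' W (mem_delFam.mpr ⟨hW, hvsW⟩)

end

end Summit.ValiantsHypothesis.ValiantsHypothesis.Theorems.BarrierLever.AnchoredPeeling
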